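import Mathlib.Analysis.Complex.Basic
import Mathlib.RingTheory.MvPolynomial.Basic
import Literature.Computability.AlgebraicComplexity.ArithCircuit
import Literature.Computability.AlgebraicComplexity.CircuitDepth
import HarnessLib

/-!
# The chasm at depth three (Gupta–Kamath–Kayal–Saptharishi 2013/2016; Tavenas 2015) — named facts

Topic `Literature/Computability/AlgebraicComplexity`; sibling of `DepthReduction.lean` (which vendors
the depth-FOUR reduction `productDepthCircuitSize_two_le_of_isVPFamily`, Tavenas 2015 Thm. 1).
This file vendors the depth-THREE reduction behind the crux `Depth3Chasm` shared by the routes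
`ValiantsHypothesis/SummationBits` and `ValiantsHypothesis/ChowBorderDepth3`
(item `stmt-ValiantsHypothesis-5935`), in the library's circuit model
(`ArithCircuit`: unbounded-fan-in weighted-sum and product gates; `productDepth`; `edgeSize` =
number of wires).

Printed statements, read this session:

* Gupta, Kamath, Kayal, Saptharishi, *Arithmetic circuits: a chasm at depth three*, ECCC TR13-026
  (2013) = FOCS 2013 = SIAM J. Comput. 45 (2016) [`GuptaKamathKayalSaptharishi2016`], **Thm. 1.1**
  (TR13-026 p. 4–5): "Let `f(x) ∈ ℂ[x]` be an `n`-variate polynomial of degree `d = n^{O(1)}`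
  computed by an arithmetic circuit of size `s`. Then it can also be computed by a `ΣΠΣ` circuit
  of size `2^{O(√(d log n log s log d))}`. Further, if `f` can be computed by an ABP of size `s`
  then it can also be computed by a `2^{O(√(d log n log s))}` sized `ΣΠΣ` circuit." **§3
  Preliminaries** (p. 7): "For the ease of book-keeping, we define the size of a circuit as the
  number of wires in the circuit" (footnote 12: "One could alternatively define the size of a
  circuit as the number of nodes …"); the final `ΣΠΣ` circuit `T = Σ_{i ≤ s(d+1)} Π_j Π_k
  (ℓ_j − α_{ijk})` (p. 12) is charged "top fan-in · degree · (n + 1)", i.e. by WIRES.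
* Tavenas, *Improved bounds for reduction to depth 4 and depth 3*, MFCS 2013 / Inform. Comput. 240
  (2015) = arXiv:1304.5777 [`Tavenas2015`], **Cor. 1** (arXiv p. 5): "Let `f(x) ∈ ℚ[x₁, …, xₙ]`
  be an `n`-variate polynomial of degree `d = n^{O(1)}` computed by an arithmetic circuit of size
  `s`. Then it can also be computed by a `ΣΠΣ` circuit of size `2^{O(√(d log n log s))}` with
  coefficients coming from `ℚ`", obtained (ibid.) by "Using Theorem 1 instead of Theorem 4.1 in
  their paper", which "improves the first part of their proof" — the depth-four step; steps two
  (Fischer's identity) and three (Saxena's duality trick and univariate factoring over the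
  algebraically closed field, TR13-026 §2 "Proof Overview" p. 7) are GKKS's and work over `ℂ`
  verbatim, the `ℚ`-coefficient refinement being the extra work of the journal version.

## Lean rendering (both facts are WEAKER than print)

* "`n`-variate, degree `d = n^{O(1)}`, computed by a circuit of size `s`": `f : MvPolynomial
  (Fin n) ℂ`, `f.totalDegree ≤ d`, `d ≤ n ^ a + a` for an exponent `a` fixed first (the `O(1)`;
  the `O`-constant `K` of the conclusion may depend on `a`), and `complexity f ≤ s` (the tree's
  fan-in-two gate count `L(f)`, Bürgisser's Def. 2.1; a fan-in-two circuit with `g` gates has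
  `≤ 2g` wires and conversely, so "size `s`" in GKKS's wire count and `complexity ≤ s` differ by a
  factor `≤ 3`, absorbed by `K`).
* "`ΣΠΣ` circuit of size `S`": an `ArithCircuit ℂ (Fin n)` of `productDepth ≤ 1` (one layer of
  product gates between weighted-sum layers — exactly `ΣΠΣ` in the unbounded-fan-in model, cf.
  `ArithCircuit.exists_computes_productDepth_one`) computing `f`, with `edgeSize ≤ S` (wires, as
  GKKS define size).
* `2^{O(√(d log n log s))}` is `2 ^ (K * Nat.sqrt (d * (Nat.log 2 n + 1) * (Nat.log 2 s + 1)) + K)`: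
  the `+1`'s and the additive `K` only WEAKEN the bound in the degenerate cases `n, s ≤ 1`,
  `d = 0` (where `d ≤ n^a + a` keeps everything bounded) and absorb the floor of `Nat.sqrt`;
  for `n, s ≥ 2` it is the printed shape up to the constant. GKKS's own bound carries the extra
  factor `(Nat.log 2 d + 1)` under the root.
* Users take `(h : sigmaPiSigma_edgeSize_le_of_complexity)` (Tavenas's form, the one route
  `SummationBits` needs: for p-bounded `s, d` it gives `(n+2)^{c√d + c}` wires) or the weaker
  `(h : gkks_sigmaPiSigma_edgeSize_le_of_complexity)`; the first implies the second
  (`gkks_of_tavenas`, proved). Nothing is asserted.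

## Deliberately NOT here

The ABP half of Thm. 1.1, the fan-in structure `ΣΠ^{[O(√d)]}…` of the intermediate depth-4/5
circuits, the `ℚ`-coefficient refinement, the depth-5 powering circuits (`Σ∧Σ∧Σ`, TR13-026
Lemma 5.5), and the converse "depth-3 lower bounds of `2^{ω(√d log^{3/2} d)}` for `Perm_d` give
general lower bounds" (a corollary the routes state themselves as `Depth3Thesis`/assembly).

## Tree search

`lean search 'productDepthCircuitSize 1|depth.?three.*chasm|ΣΠΣ'`: only docstring mentions
(`Barriers/ValiantsHypothesis/DepthReductionChasm.lean` records that nothing is vendored at depth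
three); depth four is `productDepthCircuitSize_two_le_of_isVPFamily` (`DepthReduction.lean`) and
`homProductDepthCircuitSize_two_le_of_isVPFamily` (`TavenasHomogeneous.lean`).

## References

* A. Gupta, P. Kamath, N. Kayal, R. Saptharishi, *Arithmetic circuits: a chasm at depth three*,
  SIAM J. Comput. 45(3) (2016) 1064–1079; FOCS 2013; ECCC TR13-026, Thm. 1.1, §3.
* S. Tavenas, *Improved bounds for reduction to depth 4 and depth 3*, Inform. and Comput. 240
  (2015) 2–11; MFCS 2013; arXiv:1304.5777, Thm. 1, Cor. 1.
-/

noncomputable section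

namespace Literature.Computability.AlgebraicComplexity

/-- NAMED FACT (**depth-three chasm, Tavenas 2015 Cor. 1 sharpening GKKS 2016 Thm. 1.1**): "Let
`f` be an `n`-variate polynomial of degree `d = n^{O(1)}` computed by an arithmetic circuit of size
`s`. Then it can also be computed by a `ΣΠΣ` circuit of size `2^{O(√(d log n log s))}`" (size =
number of wires, GKKS §3), over `ℂ` (GKKS TR13-026 Thm. 1.1 is stated over `ℂ`; Tavenas's
improvement replaces only the depth-four step). Rendering (module docstring): for every exponent
`a` there is `K` such that every `f : MvPolynomial (Fin n) ℂ` with `totalDegree ≤ d ≤ n^a + a` and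
fan-in-two complexity `≤ s` has a product-depth-`≤ 1` circuit with at most
`2 ^ (K ⌊√(d (log₂ n + 1)(log₂ s + 1))⌋ + K)` wires. WEAKER than print (degenerate cases padded).
Users take `(h : sigmaPiSigma_edgeSize_le_of_complexity)`.
[cite: Tavenas2015, Cor. 1] [cite: GuptaKamathKayalSaptharishi2016, Thm. 1.1 and §3 (size = wires)] -/
def sigmaPiSigma_edgeSize_le_of_complexity : Prop :=
  ∀ a : ℕ, ∃ K : ℕ, ∀ (n s d : ℕ) (f : MvPolynomial (Fin n) ℂ),
    f.totalDegree ≤ d → d ≤ n ^ a + a → complexity f ≤ s →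
      ∃ P : ArithCircuit ℂ (Fin n), P.Computes f ∧ P.productDepth ≤ 1 ∧
        P.edgeSize ≤ 2 ^ (K * Nat.sqrt (d * (Nat.log 2 n + 1) * (Nat.log 2 s + 1)) + K)

/-- NAMED FACT (**GKKS 2016, Thm. 1.1, first half, as printed with the `log d` factor**): "Let
`f(x) ∈ ℂ[x]` be an `n`-variate polynomial of degree `d = n^{O(1)}` computed by an arithmetic
circuit of size `s`. Then it can also be computed by a `ΣΠΣ` circuit of size
`2^{O(√(d log n log s log d))}`" (size = wires, §3). Same rendering with the extra factor
`(Nat.log 2 d + 1)` under the root. Users take `(h : gkks_sigmaPiSigma_edgeSize_le_of_complexity)`.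
[cite: GuptaKamathKayalSaptharishi2016, Thm. 1.1] -/
def gkks_sigmaPiSigma_edgeSize_le_of_complexity : Prop :=
  ∀ a : ℕ, ∃ K : ℕ, ∀ (n s d : ℕ) (f : MvPolynomial (Fin n) ℂ),
    f.totalDegree ≤ d → d ≤ n ^ a + a → complexity f ≤ s →
      ∃ P : ArithCircuit ℂ (Fin n), P.Computes f ∧ P.productDepth ≤ 1 ∧
        P.edgeSize ≤
          2 ^ (K * Nat.sqrt (d * (Nat.log 2 n + 1) * (Nat.log 2 s + 1) * (Nat.log 2 d + 1)) + K)

/-- Tavenas's bound implies GKKS's (the extra factor `log₂ d + 1 ≥ 1` under the square root only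
enlarges the bound). [cite: Tavenas2015, Cor. 1 (remark: "a small improvement of Theorem 1.1 in [GKKS13]")] -/
theorem gkks_of_tavenas (h : sigmaPiSigma_edgeSize_le_of_complexity) :
    gkks_sigmaPiSigma_edgeSize_le_of_complexity := by
  intro a
  obtain ⟨K, hK⟩ := h a
  refine ⟨K, fun n s d f hd hda hs => ?_⟩
  obtain ⟨P, hP, hΔ, hE⟩ := hK n s d f hd hda hs
  refine ⟨P, hP, hΔ, hE.trans ?_⟩
  apply Nat.pow_le_pow_right (by norm_num)
  have hmono : d * (Nat.log 2 n + 1) * (Nat.log 2 s + 1) ≤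
      d * (Nat.log 2 n + 1) * (Nat.log 2 s + 1) * (Nat.log 2 d + 1) :=
    Nat.le_mul_of_pos_right _ (Nat.succ_pos _)
  have := Nat.sqrt_le_sqrt hmono
  nlinarith [this, Nat.zero_le K]

end Literature.Computability.AlgebraicComplexity

end
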